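import Literature.Geometry.Lorentzian.KerrSchild
import HarnessLib

/-!
# Barrier catalogue `FinalStateConjecture`: superradiance — the stationary Killing field of Kerr is not everywhere timelike on the exterior when `a ≠ 0`
(`Literature/Barriers/FinalStateConjecture/`, D-0021; family `gr`, summit `FinalStateConjecture`;
namespace `Literature.Barriers.FinalStateConjecture`)

This file records — and **proves**, on the ingoing Kerr–Schild chart of the prelude
(`KerrSchild.lean`: `Kerr.bilin`, `Kerr.radius`, `Kerr.scalarH`, `Kerr.exterior`,
`Kerr.ergoregion`) — the geometric fact behind what the sources call *the problem of
superradiance* in the black hole stability problem: for `M > 0` and `a ≠ 0` the ergoregion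
`{x ∈ {r > r₊} | g_{M,a}(∂_{t*}, ∂_{t*}) > 0}` of the Kerr exterior is non-empty, whereas for
`a = 0` (Schwarzschild, `M ≥ 0`) it is empty. Klainerman, C. R. Mécanique 353 (2025), §2.5 (3),
p. 562: "The problem of superradiance. This is the failure of the stationary Killing field
`T = ∂_t` to be everywhere timelike in the domain of outer communication, and thus, of the
associated conserved energy to be positive. Note that this problem is absent in Schwarzschild";
fn. 26: "The stationary Killing vectorfield `T` is timelike only outside of the so-called
ergoregion." O'Neill, *The geometry of Kerr black holes* (1995), Ch. 2, §2.4 (ergosphere).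
A strengthening is proved as well: for `M > 0`, `a ≠ 0` no non-trivial constant combination
`α ∂_{t*} + β ∂_{φ*}` of the two Kerr Killing fields — in particular not the Hawking field
`∂_{t*} + (a/2Mr₊) ∂_{φ*}`, the null generator of `𝓗⁺` (Dafermos–Rodnianski, arXiv:0811.0354,
§5.2.1) — is everywhere timelike on `{r > r₊}`: "the lack of any globally timelike Killing
vector field and the resulting loss of a positive definite conserved energy"
(Chodosh–Shlapentokh-Rothman, CMP 356 (2017), §1.1.1, p. 5, on superradiance).

* `equatorialPoint ρ` — the chart point `(t*, x, y, z) = (0, ρ, 0, 0)`; for `ρ = √(r² + a²)`,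
  `r > 0`, its Kerr–Schild radius is `r` (`radius_equatorialPoint`), `H = M / r` there
  (`scalarH_equatorialPoint`) and `g(∂_{t*}, ∂_{t*}) = −1 + 2M/r` (`gtt_equatorialPoint`).
* `rPlus_lt_two_mul` — `r₊ < 2M` for `M > 0`, `a ≠ 0`.
* `kerr_ergoregion_nonempty` — `M > 0`, `a ≠ 0` ⟹ `(Kerr.ergoregion M a).Nonempty` (witness: the
  equatorial point at any radius `r₊ < r < 2M`).
* `kerr_ergoregion_eq_empty_of_spin_eq_zero` — `M ≥ 0` ⟹ `Kerr.ergoregion M 0 = ∅`.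
* `KerrSuperradiance` — **the barrier declaration** (structured block in its docstring): the
  conjunction of the two facts for every `M > 0`; `kerrSuperradiance_holds` proves it, and
  `exists_stationaryField_spacelike` restates the first half for the bundled Kerr metric and
  its stationary Killing field `Kerr.stationaryField` (`Kerr.mem_ergoregion_iff`).
* `killingCombination a r₀ α β` — `K_{α,β} = α ∂_{t*} + β ∂_{φ*}` (`Kerr.stationaryField`,
  `Kerr.axialField`); `kerr_killingCombination_spacelike_somewhere` — for `M > 0`, `a ≠ 0`,
  `(α, β) ≠ (0, 0)` there is a point of `{r > r₊}` with `g_{M,a}(K_{α,β}, K_{α,β}) > 0`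
  (PROVED: `β = 0` by the ergoregion, `β ≠ 0` at a far equatorial point, where
  `g(K, K) ≥ −α² + β²(r² + a²)`); packaged as `KerrNoTimelikeKillingCombination` /
  `kerrNoTimelikeKillingCombination_holds`, with the Hawking field as the special case
  `hawkingField_spacelike_somewhere` and the Schwarzschild contrast
  `schwarzschild_stationaryField_timelike` (`∂_{t*}` is timelike on all of `{r > 2M}`).

* **Barrier audit 2026-08-15** (appended section): `adaptedField a r₀` — the Hawking vector field
  `T̂ = ∂_{t*} + (a/(r² + a²)) ∂_{φ*}` (GKS, arXiv:2205.14808, Def. 3.2.1), an `r`-dependent,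
  non-Killing combination of the two Killing fields; `bilin_adaptedField` —
  `g_{M,a}(T̂, T̂) = −(r⁴ + a²z²)(r² − 2Mr + a²)/(r²(r² + a²)²)` (GKS Prop. 3.2.2 in Kerr–Schild
  form); `adaptedField_timelike` — `T̂` is timelike at EVERY exterior point for EVERY real `M, a`
  (PROVED), null on `{r = r₊}` (`bilin_adaptedField_eq_zero_of_radius_eq_rPlus`), horizon
  coefficient `a/(2Mr₊)` (`adaptedCoeff_rPlus`); `KerrSuperradianceNarrow` /
  `kerrSuperradianceNarrow_holds` — the narrowed barrier declaration (obstruction to CONSERVED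
  positive energies only; corrected technique class, `because:` and `evasions_known:` brought to
  the 2022–2026 literature: black-box transfer of exact-Kerr frequency-space estimates to
  perturbations of Kerr, physical-space Whiting transforms, claimed subextremal nonlinear stability).

Everything is proved; the only vendored content is the wording of the barrier docstrings, each
clause of which is a quotation with locator. Superextremal `|a| > M` is covered formally through
the prelude's junk convention `√(M² − a²) = 0` (`Kerr.rPlus`), on which nothing below depends
for `|a| ≤ M`.

## Mathlib

No Lorentzian geometry in Mathlib; only `EuclideanSpace.single`, `Real.sqrt` algebra and
order lemmas are used. Nothing here duplicates a Mathlib declaration.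

## References

* S. Klainerman, *The black hole stability problem*, C. R. Mécanique 353 (2025) 555–581, §2.5 (3)
  and fn. 26 (p. 562), §2.6.1 (p. 564), §3.2 (p. 566).
* M. Dafermos, I. Rodnianski, Y. Shlapentokh-Rothman, *Decay for solutions of the wave equation
  on Kerr exterior spacetimes III: the full subextremal case |a| < M*, Ann. of Math. 183 (2016)
  787–913 (arXiv:1402.7034), §1.1 (pp. 3, 6–7), §6.4 (p. 24), §8.2 (p. 30), §9.7 (p. 51).
* M. Dafermos, I. Rodnianski, *A proof of the uniform boundedness of solutions to the wave
  equation on slowly rotating Kerr backgrounds*, Invent. Math. 185 (2011) 467–559.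
* B. F. Whiting, *Mode stability of the Kerr black hole*, J. Math. Phys. 30 (1989) 1301–1305;
  Y. Shlapentokh-Rothman, *Quantitative mode stability for the wave equation on the Kerr
  spacetime*, Ann. Henri Poincaré 16 (2015) 289–345.
* L. Andersson, P. Blue, *Hidden symmetries and decay for the wave equation on the Kerr
  spacetime*, Ann. of Math. 182 (2015) 787–853.
* B. O'Neill, *The geometry of Kerr black holes*, A K Peters (1995), Ch. 2, §2.3–§2.4.
* O. Chodosh, Y. Shlapentokh-Rothman, *Time-periodic Einstein–Klein–Gordon bifurcations of
  Kerr*, Comm. Math. Phys. 356 (2017) 1155–1250 (arXiv:1510.08025), §1.1.1 (p. 5).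
* M. Dafermos, I. Rodnianski, *Lectures on black holes and linear waves*, Clay Math. Proc. 17
  (2013), arXiv:0811.0354, §5.2.1 (p. 29 of the arXiv version).
* E. Giorgi, S. Klainerman, J. Szeftel, *Wave equations estimates and the nonlinear stability of
  slowly rotating Kerr black holes*, arXiv:2205.14808, Def. 3.2.1, Prop. 3.2.2 (p. 120), §1.7 (p. 55).
* M. Dafermos, G. Holzegel, I. Rodnianski, M. Taylor, *Quasilinear wave equations on asymptotically
  flat spacetimes with applications to Kerr black holes*, Analysis & PDE 19 (2026) 909–1028
  (arXiv:2212.14093), §1 (p. 4), §1.4.1–1.4.2 (p. 13), §1.4.4 (p. 16); *Quasilinear wave equations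
  on Kerr black holes in the full subextremal range |a| < M*, arXiv:2410.03639.
* S. Ma, J. Szeftel, *Energy-Morawetz estimates for the wave equation in perturbations of Kerr*,
  arXiv:2410.02341 (v2, 2026), Thm. 1.4, Rem. 1.5 (p. 7), §1.4.4 (p. 10), Lemma 8.1 (pp. 144–145);
  *Energy-Morawetz estimates for Teukolsky equations in perturbations of Kerr*, arXiv:2603.23437.
* L. He, S. Klainerman, *A physical space derivation of Morawetz–energy estimates in Kerr
  spacetimes with large angular momentum*, arXiv:2607.08958 (2026), Abstract, §1.1–1.3 (pp. 6–10),
  Thm. 1.10 (p. 23).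
* D. Häfner, P. Hintz, A. Vasy, *Linear stability of Kerr black holes in the full subextremal
  range*, arXiv:2506.21183 (2025); P. Hintz, *Nonlinear stability of subextremal Kerr black holes*,
  arXiv:2606.28253 (2026) (claim, under review).
* Y. Shlapentokh-Rothman, *Exponentially growing finite energy solutions for the Klein–Gordon
  equation on sub-extremal Kerr spacetimes*, Comm. Math. Phys. 329 (2014) 859–891.
* S. Alinhac, *Energy multipliers for perturbations of the Schwarzschild metric*, Comm. Math.
  Phys. 288 (2009) 199–224 (as cited by Klainerman 2025, §3.2, p. 566).
-/

noncomputable section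

open Set

namespace Literature.Barriers.FinalStateConjecture

open Literature.Geometry.Lorentzian

/-! ### An explicit equatorial point of the Kerr–Schild chart -/

/-- The chart point `(t*, x, y, z) = (0, ρ, 0, 0)` of `E4` (on the equatorial plane `z = 0`).
Auxiliary witness for `kerr_ergoregion_nonempty`. [folklore] -/
def equatorialPoint (ρ : ℝ) : E4 := EuclideanSpace.single (1 : Fin 4) ρ

/-- Coordinates of the equatorial point: `x¹ = ρ`. [folklore] -/
@[simp] theorem equatorialPoint_apply_one (ρ : ℝ) : equatorialPoint ρ 1 = ρ := by
  simp [equatorialPoint]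

/-- Coordinates of the equatorial point: `x² = 0`. [folklore] -/
@[simp] theorem equatorialPoint_apply_two (ρ : ℝ) : equatorialPoint ρ 2 = 0 := by
  simp [equatorialPoint]

/-- Coordinates of the equatorial point: `x³ = z = 0`. [folklore] -/
@[simp] theorem equatorialPoint_apply_three (ρ : ℝ) : equatorialPoint ρ 3 = 0 := by
  simp [equatorialPoint]

/-- `‖x⃗‖² = ρ²` at the equatorial point. [folklore] -/
theorem spatialNorm_sq_equatorialPoint (ρ : ℝ) : E4.spatialNorm (equatorialPoint ρ) ^ 2 = ρ ^ 2 := by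
  rw [E4.spatialNorm_sq, equatorialPoint_apply_one, equatorialPoint_apply_two,
    equatorialPoint_apply_three]
  ring

/-- On the equatorial plane the Kerr–Schild radius solves `r² = ‖x⃗‖² − a²`: the point
`(0, √(r² + a²), 0, 0)` has radius `r` (`r > 0`). Visser, arXiv:0706.0622, (35) (the defining
quartic `r⁴ − (ρ² − a²) r² − a² z² = 0` with `z = 0`). [cite: arXiv07060622, (35)] -/
theorem radius_equatorialPoint {a r : ℝ} (hr : 0 < r) :
    Kerr.radius a (equatorialPoint √(r ^ 2 + a ^ 2)) = r := by
  have h2 : Kerr.radius a (equatorialPoint √(r ^ 2 + a ^ 2)) ^ 2 = r ^ 2 := by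
    rw [Kerr.radius_sq, spatialNorm_sq_equatorialPoint, equatorialPoint_apply_three,
      Real.sq_sqrt (by positivity)]
    have h1 : (r ^ 2 + a ^ 2 - a ^ 2) ^ 2 + 4 * a ^ 2 * (0 : ℝ) ^ 2 = (r ^ 2) ^ 2 := by ring
    rw [h1, Real.sqrt_sq (by positivity)]
    ring
  exact (pow_left_inj₀ (Kerr.radius_nonneg _ _) hr.le two_ne_zero).1 h2

/-- On the equatorial plane the Kerr–Schild scalar is `H = M r³ / r⁴ = M / r`
(Visser, arXiv:0706.0622, (33) with `z = 0`). [cite: arXiv07060622, (33)] -/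
theorem scalarH_equatorialPoint {M a r : ℝ} (hr : 0 < r) :
    Kerr.scalarH M a (equatorialPoint √(r ^ 2 + a ^ 2)) = M / r := by
  rw [Kerr.scalarH, radius_equatorialPoint hr, equatorialPoint_apply_three]
  field_simp
  ring

/-- `g_{M,a}(∂_{t*}, ∂_{t*}) = η(∂₀, ∂₀) + 2H ℓ₀² = −1 + 2M/r` at the equatorial point of radius
`r > 0` (Kerr–Schild form `g = η + 2H ℓ ⊗ ℓ`, `ℓ₀ = 1`; O'Neill 1995, Ch. 2, §2.4:
`g_tt = −1 + 2Mr/ρ²` with `ρ² = r²` on the equator). [cite: ONeill1995, Ch. 2 §2.4] -/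
theorem gtt_equatorialPoint {M a r : ℝ} (hr : 0 < r) :
    Kerr.bilin M a (equatorialPoint √(r ^ 2 + a ^ 2)) (E4.basisVector 0) (E4.basisVector 0) =
      -1 + 2 * (M / r) := by
  rw [Kerr.bilin_apply, scalarH_equatorialPoint hr, Kerr.nullCovector_basisVector_zero,
    Minkowski.bilin_basisVector_zero]
  ring

/-! ### The ergoregion is non-empty exactly when `a ≠ 0` -/

/-- For `M > 0` and `a ≠ 0` the event-horizon radius satisfies `r₊ = M + √(M² − a²) < 2M`
(for `|a| > M` by the junk convention `√(M² − a²) = 0` of `Kerr.rPlus`). O'Neill 1995, Ch. 2,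
§2.3. [cite: ONeill1995, Ch. 2 §2.3] -/
theorem rPlus_lt_two_mul {M a : ℝ} (hM : 0 < M) (ha : a ≠ 0) : Kerr.rPlus M a < 2 * M := by
  unfold Kerr.rPlus
  have h : √(M ^ 2 - a ^ 2) < M := by
    rw [Real.sqrt_lt' hM]
    have : 0 < a ^ 2 := by positivity
    linarith
  linarith

/-- **The Kerr ergoregion is non-empty for `a ≠ 0`.** For `M > 0`, `a ≠ 0`, the stationary
Killing field `∂_{t*}` is spacelike somewhere on the exterior `{r > r₊}`: at the equatorial point
of any radius `r₊ < r < 2M` one has `g(∂_{t*}, ∂_{t*}) = −1 + 2M/r > 0`. O'Neill 1995, Ch. 2,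
§2.4 (the ergosphere `r = M + √(M² − a² cos²θ)` lies outside `r₊` off the axis); Klainerman,
C. R. Mécanique 353 (2025), §2.5 (3), fn. 26. [cite: ONeill1995, Ch. 2 §2.4] [cite: Klainerman2025, §2.5 (3) fn. 26] -/
theorem kerr_ergoregion_nonempty {M a : ℝ} (hM : 0 < M) (ha : a ≠ 0) :
    (Kerr.ergoregion M a).Nonempty := by
  set r := (Kerr.rPlus M a + 2 * M) / 2 with hr_def
  have hlt := rPlus_lt_two_mul hM ha
  have hrp : M ≤ Kerr.rPlus M a := by
    unfold Kerr.rPlus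
    linarith [Real.sqrt_nonneg (M ^ 2 - a ^ 2)]
  have hr : 0 < r := by rw [hr_def]; linarith
  have hr1 : Kerr.rPlus M a < r := by rw [hr_def]; linarith
  have hr2 : r < 2 * M := by rw [hr_def]; linarith
  refine ⟨equatorialPoint √(r ^ 2 + a ^ 2), ?_, ?_⟩
  · rw [Kerr.mem_exterior, radius_equatorialPoint hr]
    exact max_lt hr1 hr
  · rw [gtt_equatorialPoint hr]
    have h1 : 1 < 2 * (M / r) := by
      rw [mul_div_assoc', lt_div_iff₀ hr]
      linarith
    linarith

/-- **The Schwarzschild exterior has no ergoregion.** For `a = 0` and `M ≥ 0`, on `{r > 2M}`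
one has `g(∂_{t*}, ∂_{t*}) = −1 + 2M/r < 0`, so `Kerr.ergoregion M 0 = ∅`: "this problem is
absent in Schwarzschild" (Klainerman, C. R. Mécanique 353 (2025), §2.5 (3)); O'Neill 1995,
Ch. 2, §2.4. [cite: Klainerman2025, §2.5 (3)] [cite: ONeill1995, Ch. 2 §2.4] -/
theorem kerr_ergoregion_eq_empty_of_spin_eq_zero {M : ℝ} (hM : 0 ≤ M) :
    Kerr.ergoregion M 0 = ∅ := by
  ext x
  simp only [Kerr.ergoregion, Set.mem_setOf_eq, Set.mem_empty_iff_false, iff_false, not_and,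
    not_lt]
  intro hx
  rw [Kerr.mem_exterior, Kerr.rPlus_zero_right hM, Kerr.radius_zero_left] at hx
  have hpos : 0 < E4.spatialNorm x := lt_of_le_of_lt (le_max_right _ _) hx
  have h2M : 2 * M < E4.spatialNorm x := lt_of_le_of_lt (le_max_left _ _) hx
  rw [Kerr.bilin_apply, Kerr.nullCovector_basisVector_zero, Minkowski.bilin_basisVector_zero,
    Kerr.scalarH, Kerr.radius_zero_left]
  have hH : M * E4.spatialNorm x ^ 3 / (E4.spatialNorm x ^ 4 + 0 ^ 2 * x 3 ^ 2) =
      M / E4.spatialNorm x := by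
    field_simp
    ring
  rw [hH]
  have h1 : 2 * (M / E4.spatialNorm x) ≤ 1 := by
    rw [mul_div_assoc', div_le_iff₀ hpos]
    linarith
  linarith

/-! ### The barrier declaration -/

/-- **Barrier (superradiance): for rotating Kerr, `a ≠ 0`, the stationary Killing field
`T = ∂_{t*}` fails to be timelike on part of the domain of outer communications (the ergoregion
is non-empty), so its conserved energy is not positive definite; for `a = 0` the ergoregion is
empty.** Statement: for every `M > 0`, `(∀ a ≠ 0, (Kerr.ergoregion M a).Nonempty) ∧
Kerr.ergoregion M 0 = ∅` — proved below (`kerrSuperradiance_holds`). Klainerman, C. R.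
Mécanique 353 (2025), §2.5 (3), p. 562: "The problem of superradiance. This is the failure of
the stationary Killing field `T = ∂_t` to be everywhere timelike in the domain of outer
communication, and thus, of the associated conserved energy to be positive. Note that this
problem is absent in Schwarzschild and, in general, for axially symmetric solutions of EVE."

BARRIER (D-0021; every clause is a quotation or close paraphrase of the cited locus):
* technique_class: kerr-stability, vectorfield-method, energy-estimates, Killing-energy, conserved-energy, small-angular-momentum, perturbation-of-Schwarzschild, small-parameter-absorption
* blocks: uniform boundedness / decay for `□_g ψ = 0`, the Teukolsky equation and linearised gravity on Kerr with `a ≠ 0` by the Schwarzschild scheme "conserved `∂_t`-energy plus red-shift" alone, and, for `|a|` not small, the extension of the slowly-rotating scheme in which the wrong-sign boundary terms are "absorbed by a small multiple of the red-shift current added to the conserved ∂_t energy" [cite: DafermosRodnianskiShlapentokhrothman2014, §1.1.1 (p. 6)] — i.e. the small-parameter route from the vendored slowly-rotating theorem gr.S05 `Literature.Geometry.Lorentzian.klainerman_szeftel_kerr_stability_small_a` (`|a| < a₀ M`) towards its all-sub-extremal-spins analogue and towards gr.S04 `Literature.Geometry.Lorentzian.SubextremalKerrStabilityConjecture`, hence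 towards clause (ii) of the final state conjecture (`Literature.Geometry.Lorentzian.Development.SettlesToKerrFamily`) for rapidly rotating final holes.
* because: for `a ≠ 0` the ergoregion `{g(∂_{t*}, ∂_{t*}) > 0} ∩ {r > r₊}` is non-empty (`kerr_ergoregion_nonempty`; ergosphere at `r = M + √(M² − a² cos²θ) > r₊` off the axis [cite: ONeill1995, Ch. 2 §2.4]), so `T` "[fails] to be everywhere timelike in the domain of outer communication, and thus, [...] the associated conserved energy [fails] to be positive" [cite: Klainerman2025, §2.5 (3) and fn. 26 (p. 562)]; when `|a| ≪ M` "superradiance is controlled by a small parameter", but for general `|a| < M` "superradiance is no longer governed by a small parameter", "for bounded frequencies with `|ω| ≥ ω_low` there is no large or small parameter to exploit", and the remaining bounded-frequency superradiant horizon term — "since we do not have a small parameter, we cannot hope to absorb this error term" — is controlled only by "a quantitative extension of Whiting's celebrated mode stability, which in particular excludes the presence not just of growing modes but also resonances on the real axis" [cite: DafermosRodnianskiShlapentokhrothman2014, §1.1 (pp. 3, 6–7), §8.2 (p. 30), §9.7 (p. 51)]; and "results based on mode decompositions depend strongly on the specific symmetries of Kerr which cannot be adapted to perturbations of Kerr"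 [cite: Klainerman2025, §2.6.1 (p. 564)]; more strongly, no constant combination `α ∂_{t*} + β ∂_{φ*}`, `(α, β) ≠ (0, 0)` — in particular not the Hawking field `∂_{t*} + (a/2Mr₊) ∂_{φ*}`, the null generator of `𝓗⁺` [cite: arXiv08110354, §5.2.1] — is everywhere timelike on `{r > r₊}` when `a ≠ 0` (`kerr_killingCombination_spacelike_somewhere`, proved), the geometric content of "the lack of any globally timelike Killing vector field and the resulting loss of a positive definite conserved energy" [cite: ChodoshShlapentokhrothman2017, §1.1.1 (p. 5)].
* evasions_known: the red-shift vector field together with the smallness of `|a|/M` (uniform boundedness on slowly rotating Kerr) [cite: DafermosRodnianski2011]; on the full sub-extremal range `|a| < M`: mode stability [cite: Whiting1989], made quantitative on the real axis [cite: Shlapentokhrothman2014], combined with frequency-localised multipliers exploiting that "superradiant frequencies are not trapped" [cite: DafermosRodnianskiShlapentokhrothman2014, §1.1.2 (p. 6) and §6.4 (p. 24)] — yielding the vendored `Literature.Geometry.Lorentzian.drsr_wave_boundedness_kerr` / `drsr_wave_polynomial_decay_kerr` — and its Teukolsky analogue [cite: ShlapentokhrothmanCosta2020] [cite: ShlapentokhrothmanCosta2023];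 for `|a| ≪ M` in physical space, hidden symmetries (commutation with the Carter operator) [cite: AnderssonBlue2015], extended to the nonlinear setting in GKS Part II [cite: GiorgiKlainermanSzeftel2022, §1.3.2]; No separation-free control of superradiance for `|a|` not small is recorded in these sources ("A purely physical space proof of the Energy–Morawetz estimate for small |a/m|", [cite: Klainerman2025, §3.2 (p. 566)]).
* scope_caveats: (a) only the geometric mechanism is formalised — `KerrSuperradiance` says the ergoregion is non-empty for `a ≠ 0` and empty for `a = 0`, and `KerrNoTimelikeKillingCombination` that no non-trivial constant combination of `∂_{t*}`, `∂_{φ*}` is everywhere timelike for `a ≠ 0`; that these two fields span ALL Killing fields of Kerr (`a ≠ 0`) is not vendored ("if `∂_{t*}` and `∂_{φ*}` span the complete set of Killing fields" [cite: arXiv08110354, §5.2.1]); no energy current, no wave/Teukolsky equation and no statement about any estimate scheme is formalised, so the attackable formal object is the geometric `Prop` (proved) and the analytic no-go rests on the quotations in `because:`; (b) the declaration quantifies over ALL `a ≠ 0`, including superextremal `|a| > M`, where `Kerr.exterior` uses the junk value `r₊ = M` of `Kerr.rPlus` (`√(M² − a²) = 0`) — the sources speak of black holes, `|a| ≤ M`;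 (c) axially symmetric perturbations of rotating Kerr are NOT blocked: the problem "is absent in Schwarzschild and, in general, for axially symmetric solutions of EVE" [cite: Klainerman2025, §2.5 (3)]; (d) the proved statement is the (formally stronger) "`∂_{t*}` is spacelike somewhere on `{r > r₊}`", the printed clause is "fails to be everywhere timelike"; (e) no source asserts that superradiance makes stability false — for `|a| < M` the linear problems are in fact resolved (`evasions_known`); (f) NARROWED by the barrier audit of 2026-08-15 — see `KerrSuperradianceNarrow` below: the classes `kerr-stability, vectorfield-method, energy-estimates` of `technique_class:` are broader than what `because:` supports (only CONSERVED, i.e. Killing, positive energies are excluded: the non-Killing Hawking field `T̂ = ∂_{t*} + (a/(r² + a²)) ∂_{φ*}` is timelike on the whole exterior for every `M, a`, `adaptedField_timelike` [cite: GiorgiKlainermanSzeftel2022, Prop. 3.2.2 (p. 120)]); the clause "cannot be adapted to perturbations of Kerr" is contradicted in print by the black-box use of the exact-Kerr frequency-space estimates on perturbations of Kerr in the full subextremal range [cite: DafermosHolzegelRodnianskiTaylor2022, §1.4.4 (p. 16)] [cite: MaSzeftel2024, Thm. 1.4 (p. 7)] [cite: HeKlainerman2026, §1.1 (p. 6)];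 and the last sentence of `evasions_known:` truncates "… was pioneered by Andersson–Blue" [cite: Klainerman2025, §3.2 (p. 566)].
* status: established — the geometric statement is proved in this file (`kerrSuperradiance_holds`); the analytic role of superradiance quoted above is the cited authors' account [cite: Klainerman2025, §2.5] [cite: DafermosRodnianskiShlapentokhrothman2014, §1.1]. -/
def KerrSuperradiance : Prop :=
  ∀ M : ℝ, 0 < M → (∀ a : ℝ, a ≠ 0 → (Kerr.ergoregion M a).Nonempty) ∧ Kerr.ergoregion M 0 = ∅

/-- The superradiance barrier statement holds (from `kerr_ergoregion_nonempty` and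
`kerr_ergoregion_eq_empty_of_spin_eq_zero`). O'Neill 1995, Ch. 2, §2.4; Klainerman, C. R.
Mécanique 353 (2025), §2.5 (3). [cite: ONeill1995, Ch. 2 §2.4] [cite: Klainerman2025, §2.5 (3)] -/
theorem kerrSuperradiance_holds : KerrSuperradiance := fun _ hM ↦
  ⟨fun _ ha ↦ kerr_ergoregion_nonempty hM ha, kerr_ergoregion_eq_empty_of_spin_eq_zero hM.le⟩

/-- Bundled form: for `M > 0`, `a ≠ 0` there is a point of the Kerr exterior spacetime
`(Kerr.exterior M a, g_{M,a})` at which the stationary Killing field `Kerr.stationaryField`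
(`∂_{t*}`) is spacelike, `0 < g(∂_{t*}, ∂_{t*})` (`Kerr.mem_ergoregion_iff`). The metric needs
the prelude's instance hypothesis `[Kerr.Facts]`. Klainerman, C. R. Mécanique 353 (2025),
§2.5 (3), fn. 26. [cite: Klainerman2025, §2.5 (3) fn. 26] -/
theorem exists_stationaryField_spacelike [Kerr.Facts] {M a : ℝ} (hM : 0 < M) (ha : a ≠ 0) :
    ∃ x : Kerr.exterior M a, 0 < (Kerr.metric M a (Kerr.rPlus M a)).val x
      (Kerr.stationaryField a _ x) (Kerr.stationaryField a _ x) := by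
  obtain ⟨x, hx⟩ := kerr_ergoregion_nonempty hM ha
  exact ⟨⟨x, hx.1⟩, (Kerr.mem_ergoregion_iff ⟨x, hx.1⟩).1 hx⟩


/-! ### No combination `α ∂_{t*} + β ∂_{φ*}` of the Kerr Killing fields is everywhere timelike
(`a ≠ 0`) -/

open scoped Manifold

/-- The constant-coefficient combination `K_{α,β} = α ∂_{t*} + β ∂_{φ*}` of the two Killing
fields of the Kerr chart (`Kerr.stationaryField`, `Kerr.axialField`); `β/α = a/(2Mr₊)`
gives the Hawking (horizon-generating) field `∂_{t*} + (a/2Mr₊) ∂_{φ*}`. Dafermos–Rodnianski,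
arXiv:0811.0354, §5.2.1. [cite: arXiv08110354, §5.2.1] -/
def killingCombination (a r₀ α β : ℝ) : Π x : Kerr.region a r₀, TangentSpace 𝓘(ℝ, E4) x :=
  fun x ↦
    (α • E4.basisVector 0 + β • ((x.1 1) • E4.basisVector 2 - (x.1 2) • E4.basisVector 1) : E4)

/-- `K_{α,β} = α ∂_{t*} + β ∂_{φ*}` in terms of the prelude fields (definitional). [folklore] -/
theorem killingCombination_apply (a r₀ α β : ℝ) (x : Kerr.region a r₀) :
    killingCombination a r₀ α β x = α • Kerr.stationaryField a r₀ x + β • Kerr.axialField a r₀ x :=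
  rfl

/-- `K_{1,0} = ∂_{t*}`. [folklore] -/
@[simp]
theorem killingCombination_one_zero (a r₀ : ℝ) :
    killingCombination a r₀ 1 0 = Kerr.stationaryField a r₀ := by
  funext x
  simp [killingCombination, Kerr.stationaryField]

/-- At the equatorial chart point `(0, ρ, 0, 0)` the combination `K_{α,β}` has Kerr–Schild
components `(α, 0, βρ, 0)`, so its Minkowski square is `η(K, K) = −α² + β²ρ²`. [folklore] -/
theorem minkowski_killingCombination_equatorialPoint {a r₀ : ℝ} (α β ρ : ℝ)
    (h : equatorialPoint ρ ∈ Kerr.region a r₀) :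
    Minkowski.bilin (killingCombination a r₀ α β ⟨equatorialPoint ρ, h⟩)
        (killingCombination a r₀ α β ⟨equatorialPoint ρ, h⟩) = -α ^ 2 + β ^ 2 * ρ ^ 2 := by
  simp only [killingCombination, equatorialPoint_apply_one, equatorialPoint_apply_two]
  rw [Minkowski.bilin_apply]
  simp [Fin.sum_univ_three, E4.basisVector]
  ring

/-- **No Killing combination is everywhere timelike on a rotating Kerr exterior.** For `M > 0`,
`a ≠ 0` and `(α, β) ≠ (0, 0)` there is a point of `{r > r₊}` at which
`g_{M,a}(K_{α,β}, K_{α,β}) > 0`: for `β = 0` a point of the ergoregion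
(`kerr_ergoregion_nonempty`), for `β ≠ 0` an equatorial point of large radius, where
`g(K, K) = η(K, K) + 2H ℓ(K)² ≥ −α² + β²(r² + a²) > 0`. Hence no current `J^K` built on a
Killing field `K ∈ span{∂_{t*}, ∂_{φ*}}` has a positive-definite conserved energy — "the lack of
any globally timelike Killing vector field and the resulting loss of a positive definite
conserved energy" (Chodosh–Shlapentokh-Rothman, CMP 356 (2017), §1.1.1, p. 5, on superradiance);
compare Dafermos–Rodnianski, arXiv:0811.0354, §5.2.1: pointwise "there exists a timelike
direction in the span of `∂_{t*}` and `∂_{φ*}` for all points outside the horizon", the Killing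
field depending on the point. [cite: ChodoshShlapentokhrothman2017, §1.1.1 (p. 5)]
[cite: arXiv08110354, §5.2.1] -/
theorem kerr_killingCombination_spacelike_somewhere [Kerr.Facts] {M a : ℝ} (hM : 0 < M)
    (ha : a ≠ 0) {α β : ℝ} (hαβ : α ≠ 0 ∨ β ≠ 0) :
    ∃ x : Kerr.exterior M a, 0 < (Kerr.metric M a (Kerr.rPlus M a)).val x
      (killingCombination a _ α β x) (killingCombination a _ α β x) := by
  rcases eq_or_ne β 0 with hβ | hβ
  · -- `β = 0`: `K = α ∂_{t*}` with `α ≠ 0`; use a point of the ergoregion.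
    have hα : α ≠ 0 := hαβ.resolve_right (not_not.mpr hβ)
    obtain ⟨x, hx⟩ := exists_stationaryField_spacelike hM ha
    refine ⟨x, ?_⟩
    subst hβ
    have hK : killingCombination a (Kerr.rPlus M a) α 0 x = α • Kerr.stationaryField a _ x := by
      rw [killingCombination_apply, zero_smul, add_zero]
    rw [hK, map_smul, map_smul, smul_apply, smul_eq_mul, smul_eq_mul]
    have : 0 < α ^ 2 := by positivity
    nlinarith
  · -- `β ≠ 0`: an equatorial point of radius `r > max r₊ 0 + |α|/|β|`.
    set r : ℝ := max (Kerr.rPlus M a) 0 + |α| / |β| + 1 with hr_def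
    have hβ' : 0 < |β| := abs_pos.mpr hβ
    have hq : 0 ≤ |α| / |β| := by positivity
    have hr0 : max (Kerr.rPlus M a) 0 < r := by rw [hr_def]; linarith
    have hr : 0 < r := lt_of_le_of_lt (le_max_right _ _) hr0
    have hmem : equatorialPoint √(r ^ 2 + a ^ 2) ∈ Kerr.region a (Kerr.rPlus M a) := by
      rw [Kerr.mem_region, radius_equatorialPoint hr]
      exact hr0
    refine ⟨(⟨equatorialPoint √(r ^ 2 + a ^ 2), hmem⟩ : Kerr.region a (Kerr.rPlus M a)), ?_⟩
    rw [Kerr.metric_val]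
    erw [Kerr.bilin_apply, minkowski_killingCombination_equatorialPoint,
      Real.sq_sqrt (by positivity)]
    have hH : 0 ≤ Kerr.scalarH M a (equatorialPoint √(r ^ 2 + a ^ 2)) :=
      Kerr.scalarH_nonneg hM.le a _
    have hℓ : 0 ≤ Kerr.nullCovector a (equatorialPoint √(r ^ 2 + a ^ 2))
          (killingCombination a _ α β ⟨equatorialPoint √(r ^ 2 + a ^ 2), hmem⟩) *
        Kerr.nullCovector a (equatorialPoint √(r ^ 2 + a ^ 2))
          (killingCombination a _ α β ⟨equatorialPoint √(r ^ 2 + a ^ 2), hmem⟩) :=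
      mul_self_nonneg _
    have hαr : |α| < |β| * r := by
      have h1 : |α| / |β| < r := by rw [hr_def]; linarith [le_max_right (Kerr.rPlus M a) 0]
      rwa [div_lt_iff₀ hβ', mul_comm] at h1
    have h2 : α ^ 2 < β ^ 2 * r ^ 2 := by
      have h3 : |α| ^ 2 < (|β| * r) ^ 2 := by
        exact pow_lt_pow_left₀ hαr (abs_nonneg α) two_ne_zero
      simpa [mul_pow, sq_abs] using h3
    nlinarith [mul_nonneg (mul_nonneg (by norm_num : (0 : ℝ) ≤ 2) hH) hℓ, sq_nonneg β,
      sq_nonneg a, mul_nonneg (sq_nonneg β) (sq_nonneg a)]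

/-- **Schwarzschild contrast: `∂_{t*}` is timelike on the whole exterior `{r > 2M}`** (so its
conserved energy is positive definite there): `g(∂_{t*}, ∂_{t*}) = −1 + 2M/r < 0` for `r > 2M`,
`M > 0`. Klainerman, C. R. Mécanique 353 (2025), §2.5 (3) ("absent in Schwarzschild");
O'Neill 1995, Ch. 2, §2.4. [cite: Klainerman2025, §2.5 (3)] [cite: ONeill1995, Ch. 2 §2.4] -/
theorem schwarzschild_stationaryField_timelike [Kerr.Facts] {M : ℝ} (hM : 0 ≤ M)
    (x : Kerr.exterior M 0) :
    (Kerr.metric M 0 (Kerr.rPlus M 0)).val x (Kerr.stationaryField 0 _ x)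
      (Kerr.stationaryField 0 _ x) < 0 := by
  have hx := x.2
  rw [Kerr.mem_exterior, Kerr.rPlus_zero_right hM, Kerr.radius_zero_left] at hx
  have hpos : 0 < E4.spatialNorm (x : E4) := lt_of_le_of_lt (le_max_right _ _) hx
  have h2M : 2 * M < E4.spatialNorm (x : E4) := lt_of_le_of_lt (le_max_left _ _) hx
  rw [Kerr.metric_val]
  change Kerr.bilin M 0 (x : E4) (E4.basisVector 0) (E4.basisVector 0) < 0
  rw [Kerr.bilin_apply, Kerr.nullCovector_basisVector_zero, Minkowski.bilin_basisVector_zero,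
    Kerr.scalarH, Kerr.radius_zero_left]
  have hH : M * E4.spatialNorm (x : E4) ^ 3 /
        (E4.spatialNorm (x : E4) ^ 4 + 0 ^ 2 * (x : E4) 3 ^ 2) =
      M / E4.spatialNorm (x : E4) := by
    field_simp
    ring
  rw [hH]
  have h1 : 2 * (M / E4.spatialNorm (x : E4)) < 1 := by
    rw [mul_div_assoc', div_lt_iff₀ hpos]
    linarith
  linarith

/-- **The strengthened barrier statement** (proved: `kerrNoTimelikeKillingCombination_holds`):
for `M > 0` and `a ≠ 0`, no non-trivial constant combination `α ∂_{t*} + β ∂_{φ*}` of the two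
Kerr Killing fields is everywhere timelike (or even everywhere causal) on the exterior
`{r > r₊}` — there is always a point where it is spacelike; whereas for `a = 0`, `∂_{t*}` is
timelike on all of `{r > 2M}` (`schwarzschild_stationaryField_timelike`). This is the formal
content of "the lack of any globally timelike Killing vector field and the resulting loss of a
positive definite conserved energy" within `span{∂_{t*}, ∂_{φ*}}` (that these span all Killing
fields of Kerr is not vendored; Dafermos–Rodnianski write "if `∂_{t*}` and `∂_{φ*}` span the
complete set of Killing fields"). Chodosh–Shlapentokh-Rothman, CMP 356 (2017), §1.1.1 (p. 5);
Dafermos–Rodnianski, arXiv:0811.0354, §5.2.1; Klainerman, C. R. Mécanique 353 (2025), §2.5 (3).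
[cite: ChodoshShlapentokhrothman2017, §1.1.1 (p. 5)] [cite: arXiv08110354, §5.2.1] -/
def KerrNoTimelikeKillingCombination : Prop :=
  ∀ [Kerr.Facts] (M a : ℝ), 0 < M → a ≠ 0 → ∀ α β : ℝ, (α ≠ 0 ∨ β ≠ 0) →
    ∃ x : Kerr.exterior M a, 0 < (Kerr.metric M a (Kerr.rPlus M a)).val x
      (killingCombination a _ α β x) (killingCombination a _ α β x)

/-- `KerrNoTimelikeKillingCombination` holds (`kerr_killingCombination_spacelike_somewhere`).
Chodosh–Shlapentokh-Rothman, CMP 356 (2017), §1.1.1 (p. 5).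
[cite: ChodoshShlapentokhrothman2017, §1.1.1 (p. 5)] -/
theorem kerrNoTimelikeKillingCombination_holds : KerrNoTimelikeKillingCombination :=
  fun _ _ hM ha _ _ h ↦ kerr_killingCombination_spacelike_somewhere hM ha h

/-- In particular the Hawking combination `∂_{t*} + (a/2Mr₊) ∂_{φ*}` (null generator of `𝓗⁺`,
Dafermos–Rodnianski, arXiv:0811.0354, §5.2.1) is spacelike somewhere on the exterior when
`a ≠ 0`, `M > 0`. [cite: arXiv08110354, §5.2.1] -/
theorem hawkingField_spacelike_somewhere [Kerr.Facts] {M a : ℝ} (hM : 0 < M) (ha : a ≠ 0) :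
    ∃ x : Kerr.exterior M a, 0 < (Kerr.metric M a (Kerr.rPlus M a)).val x
      (killingCombination a _ 1 (a / (2 * M * Kerr.rPlus M a)) x)
      (killingCombination a _ 1 (a / (2 * M * Kerr.rPlus M a)) x) :=
  kerr_killingCombination_spacelike_somewhere hM ha (Or.inl one_ne_zero)


/-! ### Barrier audit 2026-08-15 (D-0021): the obstruction is to conservation, not to positivity

The block of `KerrSuperradiance` above lists the broad classes `kerr-stability, vectorfield-method,
energy-estimates` as blocked and quotes "results based on mode decompositions … cannot be adapted
to perturbations of Kerr". The audit narrows both. (1) Formally: the `r`-dependent combination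
`T̂ = ∂_{t*} + (a/(r² + a²)) ∂_{φ*}` of the two Killing fields — the "Hawking vectorfield" of
Giorgi–Klainerman–Szeftel (arXiv:2205.14808, Def. 3.2.1, Prop. 3.2.2: "timelike for `r > r₊` and
null on the horizon", `g(T̂, T̂) = −Δ|q|²/(r² + a²)²`) — is timelike at EVERY point of the
exterior for EVERY real `(M, a)` (`adaptedField_timelike`, proved on the Kerr–Schild chart, where
`|q|² = r² + a² cos²θ = (r⁴ + a² z²)/r²`), so positive-definite energy densities built from
`span{∂_{t*}, ∂_{φ*}}` exist for all spins; what superradiance removes is the KILLING property of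
such a field (`KerrNoTimelikeKillingCombination`), i.e. exact conservation. (2) In print (2022–2026):
the exact-Kerr frequency-space estimates are used as black boxes on perturbations of Kerr in the
full subextremal range (Dafermos–Holzegel–Rodnianski–Taylor; Ma–Szeftel), a physical-space
programme reaches `|a| ≤ 0.75M` (He–Klainerman 2026), linear stability for `|a| < M` is proved
microlocally (Häfner–Hintz–Vasy 2025) and nonlinear stability of the whole subextremal family is
claimed (Hintz 2026). `KerrSuperradianceNarrow` carries the corrected block; every clause there is
a quotation with locator. -/

/-- `η(K_{α,β}, K_{α,β}) = −α² + β²(x₁² + x₂²)` at every chart point (components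
`K = (α, −βx₂, βx₁, 0)`; generalises `minkowski_killingCombination_equatorialPoint`). [folklore] -/
theorem minkowski_killingCombination (a r₀ α β : ℝ) (x : Kerr.region a r₀) :
    Minkowski.bilin (killingCombination a r₀ α β x) (killingCombination a r₀ α β x) =
      -α ^ 2 + β ^ 2 * ((x.1 1) ^ 2 + (x.1 2) ^ 2) := by
  simp only [killingCombination]
  rw [Minkowski.bilin_apply]
  simp [Fin.sum_univ_three, E4.basisVector]
  ring

/-- `ℓ(K_{α,β}) = α − βa(x₁² + x₂²)/(r² + a²)` for the Kerr–Schild null covector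
`ℓ = (1, (rx₁ + ax₂)/(r² + a²), (rx₂ − ax₁)/(r² + a²), x₃/r)` (Visser, arXiv:0706.0622, (34)):
`x₁ℓ₂ − x₂ℓ₁ = −a(x₁² + x₂²)/(r² + a²)`. [cite: arXiv07060622, (34)] -/
theorem nullCovector_killingCombination (a r₀ α β : ℝ) (x : Kerr.region a r₀) :
    Kerr.nullCovector a x.1 (killingCombination a r₀ α β x) =
      α - β * a * ((x.1 1) ^ 2 + (x.1 2) ^ 2) / (Kerr.radius a x.1 ^ 2 + a ^ 2) := by
  simp only [killingCombination]
  simp [Kerr.nullCovector, Kerr.nullCovectorFun, Fin.sum_univ_four, E4.basisVector]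
  ring

/-- On the chart domain `{r > 0}` the level sets of the Kerr–Schild radius are the confocal
ellipsoids `(x₁² + x₂²)/(r² + a²) + x₃²/r² = 1`, i.e. `x₁² + x₂² = (r² + a²)(r² − x₃²)/r²`
(the defining quartic `Kerr.radius_quartic`; Visser, arXiv:0706.0622, (35)). In Boyer–Lindquist
terms `x₁² + x₂² = (r² + a²) sin²θ`, `x₃ = r cos θ`. [cite: arXiv07060622, (35)] -/
theorem sq_add_sq_eq (a r₀ : ℝ) (x : Kerr.region a r₀) :
    (x.1 1) ^ 2 + (x.1 2) ^ 2 =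
      (Kerr.radius a x.1 ^ 2 + a ^ 2) * (Kerr.radius a x.1 ^ 2 - (x.1 3) ^ 2) /
        Kerr.radius a x.1 ^ 2 := by
  have hr := Kerr.radius_pos_of_mem_region x.2
  have hq := Kerr.radius_quartic a x.1
  rw [E4.spatialNorm_sq] at hq
  rw [eq_div_iff (pow_ne_zero 2 hr.ne')]
  linear_combination -hq

/-- **The Hawking vector field** `T̂ := ∂_{t*} + (a/(r² + a²)) ∂_{φ*}` on the Kerr chart
`Kerr.region a r₀`: the combination `K_{1, a/(r²+a²)}` of the two Killing fields with an
`r`-DEPENDENT coefficient (so `T̂` is not a Killing field for `a ≠ 0`). Giorgi–Klainerman–Szeftel,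
arXiv:2205.14808, Def. 3.2.1 (p. 120): "the vectorfield `T̂`, to which we refer as the Hawking
vectorfield, is time-like in the domain of outer communication"; He–Klainerman, arXiv:2607.08958,
§1.3 (p. 8): "`T̂ = T + (a/(r² + a²)) Z`, which is causal in the entire domain of outer
communication". [cite: GiorgiKlainermanSzeftel2022, Def. 3.2.1 (p. 120)] -/
def adaptedField (a r₀ : ℝ) (x : Kerr.region a r₀) : TangentSpace 𝓘(ℝ, E4) x :=
  killingCombination a r₀ 1 (a / (Kerr.radius a x.1 ^ 2 + a ^ 2)) x

/-- For `a = 0` (Schwarzschild) the Hawking field is the stationary field `∂_{t*}`. [folklore] -/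
theorem adaptedField_zero_left (r₀ : ℝ) : adaptedField 0 r₀ = Kerr.stationaryField 0 r₀ := by
  funext x
  simp [adaptedField]

/-- **`g_{M,a}(T̂, T̂) = −Δ|q|²/(r² + a²)²`** in Kerr–Schild Cartesian form: for every real
`M, a, r₀` and every point of `Kerr.region a r₀`,
`g(T̂, T̂) = −(r⁴ + a²x₃²)(r² − 2Mr + a²) / (r²(r² + a²)²)` (here `|q|² = r² + a²cos²θ =
(r⁴ + a²x₃²)/r²`, `Δ = r² − 2Mr + a²`). Giorgi–Klainerman–Szeftel, arXiv:2205.14808,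
Prop. 3.2.2, eq. (3.2.3) (p. 120). Proof: `g = η + 2Hℓ⊗ℓ` with
`η(T̂, T̂) = −1 + a²(x₁² + x₂²)/(r² + a²)²`, `ℓ(T̂) = 1 − a²(x₁² + x₂²)/(r² + a²)²`,
`H = Mr³/(r⁴ + a²x₃²)` and `sq_add_sq_eq`. [cite: GiorgiKlainermanSzeftel2022, Prop. 3.2.2 (3.2.3) (p. 120)] -/
theorem bilin_adaptedField (M a r₀ : ℝ) (x : Kerr.region a r₀) :
    Kerr.bilin M a x.1 (adaptedField a r₀ x) (adaptedField a r₀ x) =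
      -((Kerr.radius a x.1 ^ 4 + a ^ 2 * (x.1 3) ^ 2) *
          (Kerr.radius a x.1 ^ 2 - 2 * M * Kerr.radius a x.1 + a ^ 2)) /
        (Kerr.radius a x.1 ^ 2 * (Kerr.radius a x.1 ^ 2 + a ^ 2) ^ 2) := by
  have hr := Kerr.radius_pos_of_mem_region x.2
  have hs := sq_add_sq_eq a r₀ x
  rw [adaptedField, Kerr.bilin_apply, minkowski_killingCombination,
    nullCovector_killingCombination, hs, Kerr.scalarH]
  set r := Kerr.radius a x.1
  have h1 : r ^ 2 + a ^ 2 ≠ 0 := by positivity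
  have h2 : r ≠ 0 := hr.ne'
  have h3 : r ^ 4 + a ^ 2 * (x.1 3) ^ 2 ≠ 0 := by positivity
  field_simp
  ring

/-- `Δ = r² − 2Mr + a² > 0` on the exterior `{r > max r₊ 0}`, for ALL real `M, a` (for
`a² ≤ M²`, `r₊ = M + √(M² − a²)` is the larger root of `Δ`; for `a² > M²`,
`Δ = (r − M)² + a² − M² > 0` identically). O'Neill 1995, Ch. 2, §2.3 (`Δ > 0` on Boyer–Lindquist
block I). [cite: ONeill1995, Ch. 2 §2.3] -/
theorem delta_pos_of_mem_exterior (M a : ℝ) {x : E4} (hx : x ∈ Kerr.exterior M a) :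
    0 < Kerr.radius a x ^ 2 - 2 * M * Kerr.radius a x + a ^ 2 := by
  have hrp : Kerr.rPlus M a < Kerr.radius a x := Kerr.lt_radius_of_mem_region hx
  unfold Kerr.rPlus at hrp
  set r := Kerr.radius a x
  have hs0 : 0 ≤ √(M ^ 2 - a ^ 2) := Real.sqrt_nonneg _
  by_cases h : a ^ 2 ≤ M ^ 2
  · have hs : √(M ^ 2 - a ^ 2) ^ 2 = M ^ 2 - a ^ 2 := Real.sq_sqrt (by linarith)
    have h1 : 0 < r - M - √(M ^ 2 - a ^ 2) := by linarith
    have h2 : 0 < r - M + √(M ^ 2 - a ^ 2) := by linarith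
    nlinarith [mul_pos h1 h2]
  · have h' := not_le.1 h
    nlinarith [sq_nonneg (r - M)]

/-- **The Hawking field `T̂` is timelike on the whole Kerr exterior, for every real `M, a`.**
At every point of `{r > max r₊ 0}`, `g_{M,a}(T̂, T̂) < 0` — sub-extremal, extremal and (with the
prelude's junk `r₊ = M`) super-extremal parameters alike, with no smallness of `|a|/M`. Hence the
superradiant obstruction `KerrNoTimelikeKillingCombination` (no CONSTANT combination of `∂_{t*}`,
`∂_{φ*}` is everywhere timelike when `a ≠ 0`) is sharp in the sense that it concerns only Killing
(constant-coefficient) combinations: positive-definite energy densities `J^{T̂} · n` exist on the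
whole exterior, at the price of the non-vanishing deformation tensor of `T̂`.
Giorgi–Klainerman–Szeftel, arXiv:2205.14808, Prop. 3.2.2 (p. 120): "The vectorfield `T̂` is
timelike for `r > r₊` and null on the horizon"; used there (§1.7, p. 55) "to avoid the fact that `T`
becomes spacelike in the ergoregion"; He–Klainerman, arXiv:2607.08958, §1.3 (p. 8).
[cite: GiorgiKlainermanSzeftel2022, Prop. 3.2.2 (p. 120)] -/
theorem adaptedField_timelike (M a : ℝ) (x : Kerr.exterior M a) :
    Kerr.bilin M a x.1 (adaptedField a _ x) (adaptedField a _ x) < 0 := by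
  rw [bilin_adaptedField]
  have hr : 0 < Kerr.radius a x.1 := Kerr.radius_pos_of_mem_region x.2
  have hΔ := delta_pos_of_mem_exterior M a x.2
  have hq : 0 < Kerr.radius a x.1 ^ 4 + a ^ 2 * (x.1 3) ^ 2 := by positivity
  exact div_neg_of_neg_of_pos (neg_lt_zero.2 (mul_pos hq hΔ)) (by positivity)

/-- Bundled form of `adaptedField_timelike` for the Kerr exterior metric
`Kerr.metric M a r₊` (instance hypothesis `[Kerr.Facts]` of the prelude).
Giorgi–Klainerman–Szeftel, arXiv:2205.14808, Prop. 3.2.2 (p. 120).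
[cite: GiorgiKlainermanSzeftel2022, Prop. 3.2.2 (p. 120)] -/
theorem metric_adaptedField_neg [Kerr.Facts] (M a : ℝ) (x : Kerr.exterior M a) :
    (Kerr.metric M a (Kerr.rPlus M a)).val x (adaptedField a _ x) (adaptedField a _ x) < 0 := by
  rw [Kerr.metric_val]
  exact adaptedField_timelike M a x

/-- For `a² ≤ M²`: `r₊² + a² = 2Mr₊` (O'Neill 1995, Ch. 2, §2.3: `r₊` is a root of
`Δ = r² − 2Mr + a²`). [cite: ONeill1995, Ch. 2 §2.3] -/
theorem rPlus_sq_add_sq {M a : ℝ} (h : a ^ 2 ≤ M ^ 2) :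
    Kerr.rPlus M a ^ 2 + a ^ 2 = 2 * M * Kerr.rPlus M a := by
  unfold Kerr.rPlus
  have hs : √(M ^ 2 - a ^ 2) ^ 2 = M ^ 2 - a ^ 2 := Real.sq_sqrt (by linarith)
  linear_combination hs

/-- For `a² ≤ M²`: `Δ(r₊) = r₊² − 2Mr₊ + a² = 0` (O'Neill 1995, Ch. 2, §2.3). [cite: ONeill1995, Ch. 2 §2.3] -/
theorem delta_rPlus_eq_zero {M a : ℝ} (h : a ^ 2 ≤ M ^ 2) :
    Kerr.rPlus M a ^ 2 - 2 * M * Kerr.rPlus M a + a ^ 2 = 0 := by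
  linear_combination rPlus_sq_add_sq h

/-- For black-hole parameters `a² ≤ M²` the coefficient of `T̂` at `r = r₊` is the Hawking
angular velocity: `a/(r₊² + a²) = a/(2Mr₊)`, so on `𝓗⁺` the field `T̂` is the null generator
`∂_{t*} + (a/2Mr₊) ∂_{φ*}` of Dafermos–Rodnianski, arXiv:0811.0354, §5.2.1
(`hawkingField_spacelike_somewhere` above concerns that CONSTANT-coefficient field on the exterior).
[cite: arXiv08110354, §5.2.1] -/
theorem adaptedCoeff_rPlus {M a : ℝ} (h : a ^ 2 ≤ M ^ 2) :
    a / (Kerr.rPlus M a ^ 2 + a ^ 2) = a / (2 * M * Kerr.rPlus M a) := by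
  rw [rPlus_sq_add_sq h]

/-- `T̂` is null on the future event horizon: at a point of a horizon-penetrating chart
`Kerr.region a r₀` with `r = r₊` (and `a² ≤ M²`), `g_{M,a}(T̂, T̂) = 0`.
Giorgi–Klainerman–Szeftel, arXiv:2205.14808, Prop. 3.2.2 (p. 120): "null on the horizon
`r = r₊`". [cite: GiorgiKlainermanSzeftel2022, Prop. 3.2.2 (p. 120)] -/
theorem bilin_adaptedField_eq_zero_of_radius_eq_rPlus {M a : ℝ} (h : a ^ 2 ≤ M ^ 2) (r₀ : ℝ)
    (x : Kerr.region a r₀) (hx : Kerr.radius a x.1 = Kerr.rPlus M a) :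
    Kerr.bilin M a x.1 (adaptedField a r₀ x) (adaptedField a r₀ x) = 0 := by
  rw [bilin_adaptedField, hx, delta_rPlus_eq_zero h]
  simp

/-- **Narrowed barrier (superradiance) — barrier audit 2026-08-15 (D-0021).** Formal content,
proved (`kerrSuperradianceNarrow_holds`): (1) the obstruction, exactly as far as it reaches — for
`M > 0`, `a ≠ 0`, no non-trivial CONSTANT (= Killing) combination `α ∂_{t*} + β ∂_{φ*}` is
everywhere timelike on `{r > r₊}` (`KerrNoTimelikeKillingCombination`); (2) its exact extent — for
ALL real `M, a` the `r`-dependent combination `T̂ = ∂_{t*} + (a/(r² + a²)) ∂_{φ*}`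
(`adaptedField`) is timelike at every point of the exterior, `g(T̂, T̂) = −(r⁴ + a²z²)Δ/(r²(r² +
a²)²) < 0` (`bilin_adaptedField`, `adaptedField_timelike`), null exactly where `Δ = 0`
(`bilin_adaptedField_eq_zero_of_radius_eq_rPlus`), with horizon coefficient `a/(2Mr₊)`
(`adaptedCoeff_rPlus`). So superradiance removes the CONSERVATION of a positive-definite energy on
rotating Kerr, not the existence of positive-definite energy densities from `span{∂_{t*}, ∂_{φ*}}`.

BARRIER (D-0021; narrowed replacement of the block of `KerrSuperradiance`; every clause is a
quotation or close paraphrase of the cited locus):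
* technique_class: Killing-energy, conserved-energy, Schwarzschild-scheme (conserved `∂_t`-energy + red-shift + first-order Morawetz multipliers alone), small-parameter-absorption, perturbation-of-Schwarzschild, mass-insensitive-boundedness — and NOT the broad classes `kerr-stability`, `vectorfield-method`, `energy-estimates` of the original block (evasions (E1), (E3)–(E6)).
* blocks: (B1) any scheme whose coercivity rests on an exactly conserved current `J^K`, `K` a Killing field of Kerr `a ≠ 0` — conjunct (1) [cite: ChodoshShlapentokhrothman2017, §1.1.1 (p. 5)]; (B2) uniform boundedness / decay for `□_g ψ = 0`, Teukolsky or linearised gravity on Kerr `a ≠ 0` by the Schwarzschild scheme alone, and for `|a|` not small the slowly-rotating extension in which wrong-sign boundary terms are "absorbed by a small multiple of the red-shift current added to the conserved `∂_t` energy", because there "superradiance is no longer governed by a small parameter", "neither can superradiance be treated as a small parameter", "Since we do not have a small parameter, we cannot hope to absorb this error term" [cite: DafermosRodnianskiShlapentokhrothman2014, §1.1 (pp. 3, 6–7) and §9.7 (p. 51)]; (B3) results-level, ALL `0 < |a| < M`: any boundedness argument insensitive to adding a Klein–Gordon mass term, since for Klein–Gordon "it is now proven that there are exponentially growing solutions for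 all `|a| ≠ 0`" (the sibling barrier `KleinGordonSuperradiantInstability.lean`) [cite: DafermosRodnianskiShlapentokhrothman2014, §1 (p. 4)] [cite: ShlapentokhRothman2014KleinGordon]; (B4) for quasilinear problems at `|a| ∼ M`, a top-order purely physical-space energy identity with coercive boundary terms and no frequency input: "it is the phenomenon of superradiance which is the primary difficulty in producing this identity, not the complicated structure of trapping per se" [cite: DafermosHolzegelRodnianskiTaylor2022, §1 (p. 4)] — realised later only with currents "tailored to a finite number of wave packets defined by suitable frequency projection" in azimuthal and stationary frequencies [cite: DafermosHolzegelRodnianskiTaylor2024, Abstract]; (B5) the classical (first-order, physical-space) vectorfield method for general non-axisymmetric solutions: "it is known to fail for general solutions in Kerr, see Alinhac" [cite: Klainerman2025, §3.2 (p. 566)] [cite: Alinhac2009].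
* because: for `a ≠ 0` the ergoregion is non-empty (`kerr_ergoregion_nonempty`), `T = ∂_t` "[fails] to be everywhere timelike in the domain of outer communication, and thus, [...] the associated conserved energy [fails] to be positive. Note that this problem is absent in Schwarzschild and, in general, for axially symmetric solutions of EVE" [cite: Klainerman2025, §2.5 (3) and fn. 26 (p. 562)]; no constant combination of `∂_{t*}`, `∂_{φ*}` repairs this (conjunct (1), `kerr_killingCombination_spacelike_somewhere`); every recorded control of superradiance for general solutions at `|a|` not small uses Whiting-type mode stability as input — in frequency space [cite: Whiting1989] [cite: Shlapentokhrothman2014] [cite: DafermosRodnianskiShlapentokhrothman2014, §1.1.3 (p. 7)], as a black box (E4), or through "physical-space versions of Whiting's transform" [cite: HeKlainerman2026, Abstract (p. 1) and §§1.2–1.3 (pp. 7–10)]: "the approaches of [Ma–Szeftel] and [Hintz], despite being very different, rely on Whiting's mode stability theorem as an indispensable input" [cite: HeKlainerman2026, §1.1 (p. 7)].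
* evasions_known: (E1) NON-KILLING causal combinations of the Killing fields — conjunct (2): `T̂` "timelike for `r > r₊` and null on the horizon" for all `|a| ≤ m` [cite: GiorgiKlainermanSzeftel2022, Def. 3.2.1 and Prop. 3.2.2 (p. 120)], used "to avoid the fact that `T` becomes spacelike in the ergoregion" via a causal `T̂_δ` [cite: GiorgiKlainermanSzeftel2022, §1.7 (p. 55)]; for `|a|/m ≪ 1` "`T̂` … though not Killing, has a small deformation tensor proportional to `|a|/m`" [cite: HeKlainerman2026, §1.3 (p. 9)]; for `|a|/m ≤ 0.9` a causal vectorfield `T̊` "which is Killing and timelike in the trapping region, equal to `T̂` before the trapping, and equal to `T` everywhere else", whose bulk "supported away from the trapping region" is controlled by the Morawetz estimate — "the range for which `T̊` can be constructed far exceeds the range `|a|/m < √2/2`, for which the trapping set is disjoint from the ergoregion" [cite: HeKlainerman2026, Thm. 1.10 (p. 23)]; pointwise, "there exists a timelike direction in the span of `∂_{t*}` and `∂_{φ*}` for all points outside the horizon" [cite: arXiv08110354, §5.2.1]; (E2) `|a| ≪ M`: red-shift plus smallness [cite: DafermosRodnianski2011]; physical-space hidden symmetries [cite: AnderssonBlue2015],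 nonlinear in GKS [cite: GiorgiKlainermanSzeftel2022, §1.3.2]; (E3) exact Kerr, full `|a| < M`: quantitative mode stability plus frequency-localised currents, "Superradiant frequencies are not trapped" [cite: DafermosRodnianskiShlapentokhrothman2014, §1.1.2 (p. 6) and §6.4 (p. 24)]; Teukolsky [cite: ShlapentokhrothmanCosta2020] [cite: ShlapentokhrothmanCosta2023]; (E4) TRANSFER TO PERTURBATIONS OF KERR, full `|a| < M` — contradicting in print the clause "results based on mode decompositions … cannot be adapted to perturbations of Kerr" [cite: Klainerman2025, §2.6.1 (p. 564)] quoted by the original block: the exact-Kerr estimate is used as a "black box" linear inhomogeneous estimate — semilinear equations on Kerr `|a| < M` at once [cite: DafermosHolzegelRodnianskiTaylor2022, §1 (p. 4) and §1.4.1 (p. 13)], "there is absolutely nothing to fear in these type of frequency localisations for nonlinear applications … can thus in principle be used directly for the nonlinear problem, in fact, as 'black box' results" [cite: DafermosHolzegelRodnianskiTaylor2022, §1.4.4 (p. 16)]; quasilinear equations on Kerr, full range [cite: DafermosHolzegelRodnianskiTaylor2024, Abstract]; energy–Morawetz for `□_g ψ = F` on perturbations `g` of `g_{a,m}`, `|a|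 < m`, "compatible with nonlinear applications" [cite: MaSzeftel2024, Thm. 1.4 (p. 7)] — microlocal multipliers adapted to the `r`-foliation conditional on lower-order terms, the latter controlled by DRSR Props. 9.8.1/13.1 on exact Kerr "as a black box estimate" [cite: MaSzeftel2024, §1.4.4 (p. 10) and Lemma 8.1 (pp. 144–145)]; the Teukolsky analogue [cite: MaSzeftel2026, Abstract (p. 1)]; "This difficulty has recently been overcome by Ma and Szeftel … the remaining conceptual obstacles to the full subextremal Kerr stability conjecture have largely been removed" [cite: HeKlainerman2026, §1.1 (p. 6)]; the smallness of `|a|/m` in the slowly-rotating proof "is only needed in [GKS], mostly in the derivation of the main energy–morawetz estimates" [cite: Klainerman2025, §4.3.7 (p. 576)] [cite: MaSzeftel2024, Rem. 1.5 (p. 7)]; (E5) physical space at large `|a|`: Morawetz–energy estimates for `□_{a,m} ψ = N` on exact Kerr, `|a|/m ≤ 0.75`, by an extended Andersson–Blue method, Stogin's low-frequency technique, physical-space Whiting transforms producing "a new, asymptotically flat, Lorentz metric `g̃`, having the same symmetries as `g`, but which is such that the Killing vectorfield `T` is timelike in the entire domain of outer communication", and the causal field `T̊` of (E1) [cite: HeKlainerman2026,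 Abstract (p. 1), §§1.2–1.3 (pp. 7–10) and Thm. 1.10 (p. 23)]; (E6) microlocal/spectral methods: linear stability of Kerr in the full subextremal range [cite: HafnerHintzVasy2025]; nonlinear stability of the full subextremal family CLAIMED (unrefereed, 2026-06; data with a finite polyhomogeneous expansion plus an `O(r^{-3-ε})` remainder, generalized wave-map gauge, Nash–Moser) [cite: Hintz2026, Abstract (p. 1)] [cite: HeKlainerman2026, §1.1 (pp. 6–7)]; (E7) axisymmetry: superradiance absent [cite: Klainerman2025, §2.5 (3) (p. 562)]; a physical-space Morawetz estimate "even for the full subextremal case" for axisymmetric solutions (Stogin) [cite: Klainerman2025, §3.2 fn. 35 (p. 566)]; the quasilinear axisymmetric case "just as in Schwarzschild" [cite: DafermosHolzegelRodnianskiTaylor2022, §1.4.2 (p. 13)].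
* scope_caveats: (a) the formal objects are geometric (causal character of fields in `span{∂_{t*}, ∂_{φ*}}` on the Kerr–Schild chart); no energy current, deformation tensor, wave or Teukolsky equation is formalised — that `T̂` is not Killing for `a ≠ 0` is plain from its non-constant coefficient but the size of its deformation tensor (E1) is not vendored; (b) conjunct (2) holds for all real `M, a` (super-extremal `|a| > M` with the prelude's junk `r₊ = M`, and `M ≤ 0`, included); conjunct (1) needs `M > 0`, `a ≠ 0`; (c) what remains unrecorded in the sources read (2026-08): a multiplier-only energy–Morawetz estimate (no phase-space localisation, no mode analysis, no Whiting-type transform) for general non-axisymmetric solutions at `|a|` not small — cf. (B4), (B5) — and any physical-space treatment of `0.75 < |a|/m < 1` ("We expect this restriction to be technical" [cite: HeKlainerman2026, Abstract (p. 1)]); (d) (E6)'s nonlinear claim is under review and for a restricted data class; (E4)–(E5) are linear estimates on (perturbations of) Kerr, the nonlinear assembly for `|a| ∼ M` in the GCM framework being announced, not printed, in these sources; (e) the fragment "A purely physical space proof of the Energy–Morawetz estimate for small `|a/m|`" quoted in the original block's evasions continues in the source ", which avoids both micro-local analysis and mode decompositions, was pioneered by Andersson–Blue" [cite: Klainerman2025,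 §3.2 (p. 566)] — the record of an evasion for small `|a|`, not a statement of absence.
* status: established — both conjuncts proved in this file; narrowed from `KerrSuperradiance` by the barrier audit of 2026-08-15 (technique class restricted to conserved/Killing energies, small-parameter absorption and mass-insensitive schemes; `because:` and `evasions_known:` brought to the 2022–2026 literature). -/
def KerrSuperradianceNarrow : Prop :=
  KerrNoTimelikeKillingCombination ∧
    ∀ (M a : ℝ) (x : Kerr.exterior M a),
      Kerr.bilin M a x.1 (adaptedField a _ x) (adaptedField a _ x) < 0

/-- `KerrSuperradianceNarrow` holds: conjunct (1) is `kerrNoTimelikeKillingCombination_holds`,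
conjunct (2) is `adaptedField_timelike`. Giorgi–Klainerman–Szeftel, arXiv:2205.14808, Prop. 3.2.2
(p. 120); Chodosh–Shlapentokh-Rothman, CMP 356 (2017), §1.1.1 (p. 5).
[cite: GiorgiKlainermanSzeftel2022, Prop. 3.2.2 (p. 120)] -/
theorem kerrSuperradianceNarrow_holds : KerrSuperradianceNarrow :=
  ⟨kerrNoTimelikeKillingCombination_holds, adaptedField_timelike⟩

end Literature.Barriers.FinalStateConjecture

end
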